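import Literature.MathematicalPhysics.QuantumLattice.DWaveSourceNNNHoppingFlatTwistThermodynamicLimit
import Literature.MathematicalPhysics.QuantumLattice.DWaveSourceNNNHoppingFlatTwistReversal
import HarnessLib

/-!
# Symmetries of the flat-twisted sourced energy density `e_src^tw(t',U,μ,h;κ)`: at zero source the twist is
# invisible (`e_src^tw(…,0;κ) = e_src(…,0)`), and twist reversal `κ ↦ κ⁻¹` costs nothing

Topic `Literature/MathematicalPhysics/QuantumLattice` (namespace = path; family `hubbard`). Sequel of
`DWaveSourceNNNHoppingFlatTwistThermodynamicLimit.lean` (`E₀(dWaveSourceTorusTT'Twist L_j t' U μ h n_j)/L_j² →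
dWaveSourceEnergyDensityTT'Twist t' U μ h κ` along every sequence of sides and twists with `χ_{L_j}(n_{j,i}) = κ_i`),
passing two FINITE-torus identities of the T8 object to the limit: `groundEnergy_dWaveSourceTorusTT'Twist_zero_source`
(`DWaveSourceNNNHoppingFlatTwist.lean`: without source a flat twist with trivial holonomy is a pure gauge,
`E₀(twist n, h = 0) = E₀(A_L(0))`) and `groundEnergy_dWaveSourceTorusTT'Twist_neg`
(`DWaveSourceNNNHoppingFlatTwistReversal.lean`: `E₀(h, −n) = E₀(h, n)`, complex conjugation). For the Hubbard cuprate
cell's row T8 («sourced helicity chord», `hubbard-cq`): the hypothesis `gauge0` of the card's bookkeeping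
(`E(0, q) = E(0, 0)`) is a theorem on the thermodynamic-limit object, so the helicity chord density vanishes at
`h = 0`; and only half the twist ladder needs an engine.

* `dWaveSourceEnergyDensityTT'Twist_zero_source` — `e_src^tw(t',U,μ,0;κ) = e_src(t',U,μ,0)` for every `κ`
  realised on a trivial-holonomy sequence (`_ladder_` form for `κ = χ_b(p)`); `helicityChordDensity_zero_source` —
  the chord density `e_src^tw(0;κ) − e_src(0)` is `0`.
* `dWaveSourceEnergyDensityTT'Twist_inv` — `e_src^tw(t',U,μ,h;κ⁻¹) = e_src^tw(t',U,μ,h;κ)` (the reversed twists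
  `−n_j` realise `κ⁻¹`); hence the chord densities at `κ` and `κ⁻¹` agree.
* `dWaveSourceEnergyDensityTT'Twist_le_zero_field_twist` — `e_src^tw(h;κ) ≤ e_src^tw(0;κ)` (the source only
  lowers the twisted energy density: `varq` of the card's bookkeeping, in the limit).

HONEST SCOPE: identities / one inequality between thermodynamic-limit grand-canonical energy densities; no number,
nothing about superconductivity. Everything is PROVED; no definition, no named fact.

## References
* H. Watanabe, J. Stat. Phys. 177 (2019) 717, §2.2.1–§2.2.3 (flat twists with trivial holonomy are pure gauges).
  [cite: Watanabe2019, §2.2.3]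
* T. Koma, H. Tasaki, J. Stat. Phys. 76 (1994) 745, §1 (sourced Hamiltonians; volume limit first).
  [cite: KomaTasaki1994, §1]
* D. Ruelle, *Statistical Mechanics* (1969), §3.3 (energy densities as limits). [cite: Ruelle1969, §3.3]
-/

noncomputable section

namespace Literature.MathematicalPhysics.QuantumLattice

open _root_.Matrix Finset HubbardWave0 Literature.Probability.LatticeModels _root_.Filter
open scoped _root_.Topology

section ZeroSource

/-- **At zero source the twist is invisible in the thermodynamic limit**: for every `κ ∈ U(1)²` realised on a
trivial-holonomy sequence (sides `L_j → ∞`, twists `n_j` with `χ_{L_j}(n_{j,i}) = κ_i`),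
`e_src^tw(t',U,μ,0;κ) = e_src(t',U,μ,0)` — the card's hypothesis `gauge0` on the limit object.
[cite: Watanabe2019, §2.2.3] -/
theorem dWaveSourceEnergyDensityTT'Twist_zero_source (t' U μ : ℝ) (κ : Fin 2 → Circle)
    (Ls : ℕ → ℕ) [∀ j, NeZero (Ls j)] (hLs : Tendsto Ls atTop atTop) (n : ∀ j, Fin 2 → ZMod (Ls j))
    (hn : ∀ j i, ZMod.toCircle (n j i) = κ i) :
    dWaveSourceEnergyDensityTT'Twist t' U μ 0 κ = dWaveSourceEnergyDensityTT' t' U μ 0 := by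
  have h1 := tendsto_groundEnergy_dWaveSourceTorusTT'Twist_div_sq t' U μ 0 κ Ls hLs n hn
  have h2 : Tendsto (fun j => (dWaveSourceTorusTT'Twist (Ls j) t' U μ 0 (n j)).groundEnergy / ((Ls j : ℕ) : ℝ) ^ 2)
      atTop (𝓝 (dWaveSourceEnergyDensityTT' t' U μ 0)) := by
    refine (tendsto_groundEnergy_dWaveSourceTorusTT'_div_sq_comp hLs t' U μ 0).congr' ?_
    filter_upwards [hLs.eventually_ge_atTop 3] with j hj
    rw [groundEnergy_dWaveSourceTorusTT'Twist_zero_source (Ls j) hj]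
  exact tendsto_nhds_unique h1 h2

/-- Ladder form: `e_src^tw(t',U,μ,0; χ_b(p)) = e_src(t',U,μ,0)` for every `b ≥ 1`, `p ∈ ℕ²`. [cite: Watanabe2019, §2.2.3] -/
theorem dWaveSourceEnergyDensityTT'Twist_ladder_zero_source (t' U μ : ℝ) (b : ℕ) [NeZero b] (p : Fin 2 → ℕ) :
    dWaveSourceEnergyDensityTT'Twist t' U μ 0 (fun i => ZMod.toCircle ((p i : ℕ) : ZMod b)) =
      dWaveSourceEnergyDensityTT' t' U μ 0 :=
  dWaveSourceEnergyDensityTT'Twist_zero_source t' U μ _ (fun m => b * (m + 1))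
    ((tendsto_add_atTop_nat 1).const_mul_atTop' (Nat.pos_of_ne_zero (NeZero.ne b)))
    (fun m i => ((p i * (m + 1) : ℕ) : ZMod (b * (m + 1)))) (fun m i => toCircle_mul_eq b (m + 1) (p i))

/-- **The helicity chord density vanishes at zero source**: `e_src^tw(t',U,μ,0;κ) − e_src(t',U,μ,0) = 0` for every
realised `κ`. [cite: Watanabe2019, §2.2.3] -/
theorem helicityChordDensity_zero_source (t' U μ : ℝ) (κ : Fin 2 → Circle)
    (Ls : ℕ → ℕ) [∀ j, NeZero (Ls j)] (hLs : Tendsto Ls atTop atTop) (n : ∀ j, Fin 2 → ZMod (Ls j))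
    (hn : ∀ j i, ZMod.toCircle (n j i) = κ i) :
    dWaveSourceEnergyDensityTT'Twist t' U μ 0 κ - dWaveSourceEnergyDensityTT' t' U μ 0 = 0 := by
  rw [dWaveSourceEnergyDensityTT'Twist_zero_source t' U μ κ Ls hLs n hn, sub_self]

/-- **The source only lowers the twisted energy density** (`varq` of the card's bookkeeping, in the limit):
`e_src^tw(t',U,μ,h;κ) ≤ e_src^tw(t',U,μ,0;κ)` for every realised `κ`. [cite: KomaTasaki1994, §1] -/
theorem dWaveSourceEnergyDensityTT'Twist_le_zero_field_twist (t' U μ h : ℝ) (κ : Fin 2 → Circle)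
    (Ls : ℕ → ℕ) [∀ j, NeZero (Ls j)] (hLs : Tendsto Ls atTop atTop) (n : ∀ j, Fin 2 → ZMod (Ls j))
    (hn : ∀ j i, ZMod.toCircle (n j i) = κ i) :
    dWaveSourceEnergyDensityTT'Twist t' U μ h κ ≤ dWaveSourceEnergyDensityTT'Twist t' U μ 0 κ := by
  rw [dWaveSourceEnergyDensityTT'Twist_zero_source t' U μ κ Ls hLs n hn]
  exact dWaveSourceEnergyDensityTT'Twist_le_zero_source t' U μ h κ Ls hLs n hn

end ZeroSource

section Reversal

/-- Reversed twists realise the inverse bond phases: `χ_L(−n_i) = κ_i⁻¹`. [cite: Watanabe2019, §2.2.1] -/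
theorem toCircle_neg_eq_inv_of_eq {L : ℕ} [NeZero L] {κ : Fin 2 → Circle} {n : Fin 2 → ZMod L}
    (hn : ∀ i, ZMod.toCircle (n i) = κ i) (i : Fin 2) : ZMod.toCircle ((-n) i) = κ⁻¹ i := by
  rw [Pi.neg_apply, Pi.inv_apply, AddChar.map_neg_eq_inv, hn i]

/-- **Twist reversal costs nothing in the thermodynamic limit**: `e_src^tw(t',U,μ,h;κ⁻¹) = e_src^tw(t',U,μ,h;κ)` for
every `κ` realised on a trivial-holonomy sequence (finite tori: `E₀(h, −n) = E₀(h, n)` by complex conjugation,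
`groundEnergy_dWaveSourceTorusTT'Twist_neg`). [cite: KomaTasaki1994, §1] -/
theorem dWaveSourceEnergyDensityTT'Twist_inv (t' U μ h : ℝ) (κ : Fin 2 → Circle)
    (Ls : ℕ → ℕ) [∀ j, NeZero (Ls j)] (hLs : Tendsto Ls atTop atTop) (n : ∀ j, Fin 2 → ZMod (Ls j))
    (hn : ∀ j i, ZMod.toCircle (n j i) = κ i) :
    dWaveSourceEnergyDensityTT'Twist t' U μ h κ⁻¹ = dWaveSourceEnergyDensityTT'Twist t' U μ h κ := by
  have h1 := tendsto_groundEnergy_dWaveSourceTorusTT'Twist_div_sq t' U μ h κ⁻¹ Ls hLs (fun j => -n j)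
    (fun j i => toCircle_neg_eq_inv_of_eq (hn j) i)
  have h2 := tendsto_groundEnergy_dWaveSourceTorusTT'Twist_div_sq t' U μ h κ Ls hLs n hn
  simp_rw [groundEnergy_dWaveSourceTorusTT'Twist_neg] at h1
  exact tendsto_nhds_unique h1 h2

/-- Hence the helicity chord densities at `κ` and `κ⁻¹` agree (only half of the twist ladder needs an engine).
[cite: KomaTasaki1994, §1] -/
theorem helicityChordDensity_inv (t' U μ h : ℝ) (κ : Fin 2 → Circle)
    (Ls : ℕ → ℕ) [∀ j, NeZero (Ls j)] (hLs : Tendsto Ls atTop atTop) (n : ∀ j, Fin 2 → ZMod (Ls j))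
    (hn : ∀ j i, ZMod.toCircle (n j i) = κ i) :
    dWaveSourceEnergyDensityTT'Twist t' U μ h κ⁻¹ - dWaveSourceEnergyDensityTT' t' U μ h =
      dWaveSourceEnergyDensityTT'Twist t' U μ h κ - dWaveSourceEnergyDensityTT' t' U μ h := by
  rw [dWaveSourceEnergyDensityTT'Twist_inv t' U μ h κ Ls hLs n hn]

end Reversal

end Literature.MathematicalPhysics.QuantumLattice

end
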